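import Summits.HodgeConjecture.HodgeConjecture.Theses.LinearSystemTorelli
import Literature.AlgebraicGeometry.HodgeTheory.GysinKernelProofs
import Literature.AlgebraicGeometry.HodgeTheory.ComplexGysinHodgeType
import Literature.AlgebraicTopology.SingularHomology.GysinTransposition

/-!
# Route LinearSystemTorelli — crux `TranscendentalOrSupported` (stmt-HodgeConjecture-10853),
# line `Sketch`: the stub `stub_invisibleOfPerpSwept` (transposition)

For `X` smooth projective of dimension `2p`, an orientation family `μ` and a class
`c ∈ H²ᵖ(X(ℂ); ℂ)` which is right-cup-orthogonal to every Gysin image `g_* y`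
(`g : Y ⟶ X`, `Y` smooth projective of dimension `m < 2p`, `y ∈ Hᵃ(Y(ℂ); ℂ)`, `a + 4p = 2p + 2m`,
Gysin morphism `complexGysin μ hY hX g hab` of `HodgeTheory/ComplexGysin`), the class `c` is
INVISIBLE: `g^* c = 0` in `H²ᵖ(Y(ℂ); ℂ)` for every such `(Y, g)`.

Proof (finite-dimensional linear algebra on the tree's carriers): fix `(m, Y, g)`. If `2m < 2p` then
`H²ᵖ(Y(ℂ); ℂ) = 0` (`subsingleton_complexBetti`). Otherwise `a = 2m - 2p`; the Gysin morphism is the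
topological one through `H_{2p}` (`complexGysin_eq_gysinMap`), the cup pairing transposes it into the
pull-back, `⟨g_* y ⌣ c, [X(ℂ)]⟩ = ⟨y ⌣ g^* c, [Y(ℂ)]⟩` (`cupPairing_gysinMap`, with Poincaré duality
of `μ` from `OrientationFamily.hasPoincareDuality`), so `g^* c` is right-orthogonal to all of
`Hᵃ(Y(ℂ); ℂ)` and vanishes by the right non-degeneracy of the perfect cup pairing of the closed
manifold `Y(ℂ)` over the field `ℂ` (`isPerfPair_cupPairing_of_field_holds`, Hatcher Prop. 3.38).
-/

set_option linter.dupNamespace false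

noncomputable section

namespace Summit.HodgeConjecture.HodgeConjecture.Theorems

open CategoryTheory
open Literature.AlgebraicGeometry.Motives Literature.AlgebraicGeometry.HodgeTheory
open Literature.AlgebraicTopology.SingularHomology

/-- **Stub `stub_invisibleOfPerpSwept` (transposition)**: for `X` smooth projective of dimension `2p`,
an orientation family `μ` and `c ∈ H²ᵖ(X(ℂ); ℂ)` with `⟨g_* y ⌣ c, [X(ℂ)]⟩ = 0` for every `g : Y ⟶ X`,
`Y` smooth projective of dimension `m < 2p`, and every `y ∈ Hᵃ(Y(ℂ); ℂ)`, `a + 4p = 2p + 2m`: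
`g^* c = 0` in `H²ᵖ(Y(ℂ); ℂ)` for all such `(Y, g)`. If `2m < 2p` the target is `0`
(`subsingleton_complexBetti`); else `a = 2m - 2p`, `complexGysin_eq_gysinMap`, the transposition
`cupPairing_gysinMap` (`⟨g_* y ⌣ c, [X]⟩ = ⟨y ⌣ g^* c, [Y]⟩`, Poincaré duality from
`OrientationFamily.hasPoincareDuality`) and right-perfectness of the cup pairing of `Y(ℂ)`
(`isPerfPair_cupPairing_of_field_holds`). [cite: FultonYoungTableaux1997, Appendix B §B.1 (5)–(6)]
[cite: HatcherAT2002, §3.3 Prop. 3.38] -/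
theorem stub_invisibleOfPerpSwept :
    ∀ (μ : OrientationFamily) ⦃p : ℕ⦄ ⦃X : SchemeOver ℂ⦄ (hX : IsSmoothProjective (2 * p) X)
    (c : complexBetti X (2 * p)),
    (∀ (m : ℕ) (Y : SchemeOver ℂ) (hY : IsSmoothProjective m Y), m < 2 * p → ∀ (g : Y ⟶ X) (a : ℕ)
      (hab : a + 2 * (2 * p) = 2 * p + 2 * m) (y : complexBetti Y a),
      cupPairing (μ hX) (two_mul (2 * p)).symm (complexGysin μ hY hX g hab y) c = 0) →
    ∀ (m : ℕ) (Y : SchemeOver ℂ), IsSmoothProjective m Y → m < 2 * p → ∀ g : Y ⟶ X,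
      complexBetti.map g (2 * p) c = 0 := by
  intro μ p X hX c hc m Y hY hm g
  by_cases hlt : 2 * m < 2 * p
  · -- `H²ᵖ(Y(ℂ); ℂ) = 0` above the real dimension `2m` of `Y(ℂ)`
    haveI := subsingleton_complexBetti hY hlt
    exact Subsingleton.elim _ _
  · -- degrees: `a + 2p = 2m`, `2p + 2p = 2 (2p)`
    obtain ⟨a, ha⟩ : ∃ a, a + 2 * p = 2 * m := ⟨2 * m - 2 * p, by omega⟩
    have hab : a + 2 * (2 * p) = 2 * p + 2 * m := by omega
    -- the closed oriented `2m`-manifold `Y(ℂ)`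
    letI := hY.chartedSpace
    haveI := ComplexPoints.compactSpace_of_isSmoothProjective hY
    haveI := ComplexPoints.t2Space_of_isSmoothProjective hY
    -- the cup pairing `Hᵃ(Y(ℂ)) × H²ᵖ(Y(ℂ)) → ℂ` is perfect; use its right non-degeneracy
    have hP : (cupPairing (μ hY) ha).IsPerfPair := isPerfPair_cupPairing_of_field_holds
    apply hP.bijective_right.1
    rw [map_zero]
    refine LinearMap.ext fun y => ?_
    -- `⟨y ⌣ g^* c, [Y]⟩ = ⟨g_* y ⌣ c, [X]⟩ = 0`
    have key := hc m Y hY hm g a hab y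
    rw [complexGysin_eq_gysinMap hY hX g hab ha (two_mul (2 * p)).symm,
      cupPairing_gysinMap (μ.hasPoincareDuality hX) _ ha (two_mul (2 * p)).symm y c] at key
    rw [LinearMap.flip_apply, LinearMap.zero_apply]
    exact key

end Summit.HodgeConjecture.HodgeConjecture.Theorems

end
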